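import Literature.Computability.Cryptography.RegevStagePost
import Literature.Computability.Cryptography.PeikertBDDIdealised
import Literature.Algebra.EuclideanLattices.LatticeProblemsProofs
import HarnessLib

/-!
# Regev 2009, Lemma 3.3 in machine form: the query format and the answer of the `CVP` subroutine

Topic `Computability/Cryptography` (family `pqc`), grouping namespace `Regev2009.CVPOracle`. In the
iterative step of Regev's reduction (J. ACM 56 (2009), art. 34; author's version arXiv:2401.03703,
Lemma 3.3) the quantum sampler of Lemma 3.14 calls "an oracle that solves `CVP_{L*,d}`" — the classical
procedure of Lemma 3.4, built from the `LWE` oracle and the batch of `D_{L,r}` samples — and uses its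
answer, the coefficient VECTOR of the closest dual lattice point, to uncompute a register ("using the
CVP oracle, we can recover `x` … this allows us to uncompute the first register", proof of Lemma 3.14).
In the tree's circuit model such a many-bit subroutine is called through the function-valued tidy
block of `QuantumComplexity/TidyBlockFn.lean` (BBBV 1997, Thm. 4.14: compute, copy the answer REGISTER,
uncompute), ONCE per value, the query being read off fixed wires. This file fixes the query format and
the answer shared by the two halves of the step (the sampler asks, the `CVP` procedure answers), so
that they can be built and analysed independently. Since the sampler asks in SUPERPOSITION over the
points, the part of the query string that varies with the point has a fixed layout: a FIXED-WIDTH bit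
table (Regev, proof of Lemma 3.14: "a state on `n log R` qubits", `R` a power of two; the point
`x mod P(L*)` of `L*/R` is its residue vector `s ∈ ℤ_Rⁿ`), placed LAST in the pairing so that it
appears verbatim:

* `CVPOracle.bitsMSB ℓ v` (the `ℓ`-bit numeral of `v`, most significant bit first — the convention of
  `GaussianCells.lean`), `CVPOracle.table ℓ s` (the `n` blocks of a vector `s : Fin n → ℕ`),
  `CVPOracle.tableZ ℓ c` (offset binary `c + 2^{ℓ-1}` for an integer vector); injectivity on in-range
  data (`bitsMSB_injOn`, `table_injOn`);
* query data `c = (s, ℓ_R, b_c)` (`CVPOracle.QData n`): the residues `s` (in range when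
  `s j < 2^{ℓ_R}`, `CVPOracle.InRange`), the exponent of `R = 2^{ℓ_R}` and the width `b_c` of the
  entries of the answer table; `CVPOracle.point I c = Σⱼ (sⱼ/2^{ℓ_R}) b^∨ⱼ`, the point of `L(B)*/R` with
  residues `s` (`Peikert2009.dualVec`, the dual basis `B^{-T}`);
* `CVPOracle.coords I t` — the dual coordinates of the (unique) point of `L(B)*` at distance
  `< λ₁(L(B)*)/2` from `t`, junk `0` when there is none (`coords_eq_repr`, by uniqueness
  `eq_of_norm_sub_lt`); **`CVPOracle.answerTable I c = tableZ b_c (coords I (point I c))`** — the answer;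
* `CVPOracle.query I r k y c = ⟨⟨⟨x, ⟨1^{k+1}, y⟩⟩, ⟨bin ℓ_R, bin b_c⟩⟩, table ℓ_R s⟩` — the stage input
  of the sampler (instance code `x = ⟨B, r⟩`, level, window `y` carrying the batch), the two numerals,
  then the table VERBATIM (`query_eq_append`); `query_injOn` (in-range data are determined by their
  query strings);
* `CVPOracle.answerFn I r k y kq ℓ : {0,1}^{kq} → {0,1}^ℓ` — **the ideal answer function** of a call of
  query width `kq` and answer width `ℓ` at `(I, r, k, y)`: the first `ℓ` bits of the answer table on
  the query strings of in-range data, `0…0` on every other string; **`answerFn_query`**.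

Everything is proved; definitions have bodies; no named fact is introduced.

## References

* O. Regev, *On lattices, learning with errors, random linear codes, and cryptography*, J. ACM 56
  (2009), art. 34; author's version arXiv:2401.03703: Lemma 3.3 (proof), Lemma 3.4 (`CVP_{L*,d}`:
  "the coefficient vector of the closest vector"), Lemma 3.14 (proof: "a state on `n log R` qubits …
  the natural mapping between `L*/R ∩ P(L*)` and `ℤ_Rⁿ`"; "using the CVP oracle … uncompute")
  [Regev2009].
* C. H. Bennett, E. Bernstein, G. Brassard, U. Vazirani, *Strengths and weaknesses of quantum
  computing*, SIAM J. Comput. 26 (1997), Thm. 4.14 [BennettBernsteinBrassardVazirani1997].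
* C. Peikert, *Public-key cryptosystems from the worst-case shortest vector problem*, STOC 2009,
  §2.1 (the dual basis) [Peikert2009].
* S. Arora, B. Barak, *Computational Complexity: A Modern Approach*, CUP 2009, §0.1 (pairing and
  codes) [AroraBarak2009].
-/

noncomputable section

namespace Literature.Computability.Cryptography

namespace Regev2009

namespace CVPOracle

open _root_.Computability Literature.Computability.Complexity Brick QuantumComplexity
  Literature.Algebra.EuclideanLattices Literature.Computability.Cryptography.Peikert2009
open scoped InnerProductSpace

/-! ### Fixed-width numerals and tables -/

/-- **The `ℓ`-bit numeral of `v`, most significant bit first** (bits of weight `≥ 2^ℓ` are dropped).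
[cite: Regev2009, Lemma 3.14 (proof: "a state on n log R qubits")] -/
def bitsMSB (ℓ v : ℕ) : List Bool := List.ofFn fun t : Fin ℓ => v.testBit (ℓ - 1 - t)

/-- The numeral has `ℓ` bits. [folklore] -/
@[simp] theorem length_bitsMSB (ℓ v : ℕ) : (bitsMSB ℓ v).length = ℓ := List.length_ofFn

/-- **Fixed-width numerals are injective on `[0, 2^ℓ)`.** [folklore] -/
theorem bitsMSB_injOn {ℓ v v' : ℕ} (hv : v < 2 ^ ℓ) (hv' : v' < 2 ^ ℓ) (h : bitsMSB ℓ v = bitsMSB ℓ v') : v = v' := by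
  have hb := List.ofFn_inj.1 h
  apply Nat.eq_of_testBit_eq
  intro i
  by_cases hi : i < ℓ
  · have := congrFun hb ⟨ℓ - 1 - i, by omega⟩
    simp only at this
    rwa [show ℓ - 1 - (ℓ - 1 - i) = i by omega] at this
  · rw [Nat.testBit_lt_two_pow (lt_of_lt_of_le hv (Nat.pow_le_pow_right two_pos (by omega))),
      Nat.testBit_lt_two_pow (lt_of_lt_of_le hv' (Nat.pow_le_pow_right two_pos (by omega)))]

/-- **The table of a vector of naturals**: its `n` numerals of `ℓ` bits, in order. [folklore] -/
def table {n : ℕ} (ℓ : ℕ) (s : Fin n → ℕ) : List Bool := (List.ofFn fun j => bitsMSB ℓ (s j)).flatten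

/-- **The table of an integer vector in offset binary**: entry `z` is written as the `ℓ`-bit numeral of
`z + 2^{ℓ-1}` (junk when out of `[-2^{ℓ-1}, 2^{ℓ-1})`). [folklore] -/
def tableZ {n : ℕ} (ℓ : ℕ) (c : Fin n → ℤ) : List Bool := (List.ofFn fun j => bitsMSB ℓ (c j + 2 ^ (ℓ - 1)).toNat).flatten

/-- Concatenations of blocks of a common length are injective. [folklore] -/
theorem flatten_injOn_of_length_eq {ℓ : ℕ} : ∀ (L L' : List (List Bool)), L.length = L'.length →
    (∀ a ∈ L, a.length = ℓ) → (∀ a ∈ L', a.length = ℓ) → L.flatten = L'.flatten → L = L'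
  | [], [], _, _, _, _ => rfl
  | [], _ :: _, h, _, _, _ => absurd h (by simp)
  | _ :: _, [], h, _, _, _ => absurd h (by simp)
  | a :: L, a' :: L', hlen, hL, hL', h => by
    rw [List.flatten_cons, List.flatten_cons] at h
    have ha : a.length = a'.length := by rw [hL a (by simp), hL' a' (by simp)]
    obtain ⟨h1, h2⟩ := List.append_inj h ha
    rw [h1, flatten_injOn_of_length_eq L L' (by simpa using hlen) (fun b hb => hL b (by simp [hb]))
      (fun b hb => hL' b (by simp [hb])) h2]

/-- **Tables are injective on in-range vectors.** [folklore] -/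
theorem table_injOn {n ℓ : ℕ} {s s' : Fin n → ℕ} (hs : ∀ j, s j < 2 ^ ℓ) (hs' : ∀ j, s' j < 2 ^ ℓ)
    (h : table ℓ s = table ℓ s') : s = s' := by
  have hblocks := flatten_injOn_of_length_eq (ℓ := ℓ) (List.ofFn fun j => bitsMSB ℓ (s j)) (List.ofFn fun j => bitsMSB ℓ (s' j))
    (by simp) (fun a ha => by obtain ⟨j, rfl⟩ := (List.mem_ofFn' _ _).1 ha; simp)
    (fun a ha => by obtain ⟨j, rfl⟩ := (List.mem_ofFn' _ _).1 ha; simp) h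
  funext j
  exact bitsMSB_injOn (hs j) (hs' j) (congrFun (List.ofFn_inj.1 hblocks) j)

/-! ### Query data, the query point and the answer -/

/-- **Query data** `(s, ℓ_R, b_c)`: residues, exponent of `R = 2^{ℓ_R}`, width of the answer entries.
[cite: Regev2009, Lemma 3.14 (proof)] -/
abbrev QData (n : ℕ) : Type := (Fin n → ℕ) × ℕ × ℕ

/-- The residues are in range: `s j < R = 2^{ℓ_R}`. [folklore] -/
def InRange {n : ℕ} (c : QData n) : Prop := ∀ j, c.1 j < 2 ^ c.2.1

/-- **The query point** of residues `s`: `Σⱼ (sⱼ/2^{ℓ_R}) b^∨ⱼ ∈ L(B)*/R` (and `0` on a singular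
instance, where there is no dual basis). [cite: Regev2009, Lemma 3.14 (proof: "the natural mapping between L*/R ∩ P(L*) and ℤ_Rⁿ")] -/
def point (I : LatticeInstance) (c : QData I.n) : EuclideanSpace ℝ (Fin I.n) :=
  if h : I.IsNonsingular then
    haveI := I.isZLattice_of_isNonsingular h
    ∑ j, ((c.1 j : ℝ) / 2 ^ c.2.1) • dualVec I j
  else 0

/-- The query point on a nonsingular instance. [folklore] -/
theorem point_eq (I : LatticeInstance) [IsZLattice ℝ I.lattice] (c : QData I.n) :
    point I c = ∑ j, ((c.1 j : ℝ) / 2 ^ c.2.1) • dualVec I j := by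
  rw [point, dif_pos (isNonsingular_of_isZLattice I)]

/-- **Uniqueness of the close dual lattice point**: two points of `L(B)*` both at distance
`< λ₁(L(B)*)/2` from `t` coincide. [cite: Regev2009, Lemma 3.4 ("0 < d < λ₁(L)/2 … the closest vector")] -/
theorem eq_of_norm_sub_lt (I : LatticeInstance) {t : EuclideanSpace ℝ (Fin I.n)}
    {v w : EuclideanSpace ℝ (Fin I.n)} (hv : v ∈ dualLattice I.lattice) (hw : w ∈ dualLattice I.lattice)
    (hvt : ‖t - v‖ < minNorm (dualLattice I.lattice) / 2) (hwt : ‖t - w‖ < minNorm (dualLattice I.lattice) / 2) :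
    v = w := by
  by_contra hne
  have hsub : v - w ∈ dualLattice I.lattice := Submodule.sub_mem _ hv hw
  have hnz : v - w ≠ 0 := sub_ne_zero.2 hne
  have hmin : minNorm (dualLattice I.lattice) ≤ ‖v - w‖ := minNorm_le_norm_of_mem hsub hnz
  have htri : ‖v - w‖ ≤ ‖t - v‖ + ‖t - w‖ := by
    calc ‖v - w‖ = ‖(t - w) - (t - v)‖ := by congr 1; abel
      _ ≤ ‖t - w‖ + ‖t - v‖ := norm_sub_le _ _
      _ = ‖t - v‖ + ‖t - w‖ := add_comm _ _
  linarith

open scoped Classical in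
/-- **The answer of the oracle**: the dual coordinates of the point of `L(B)*` within `λ₁(L(B)*)/2` of
`t` (the coefficient vector `(L*)^{-1} κ_{L*}(t)` of the closest vector), and `0` if there is no such
point or the instance is singular. [cite: Regev2009, Lemma 3.4 ("L^{-1}κ_L(x), the coefficient vector of the closest vector")] -/
def coords (I : LatticeInstance) (t : EuclideanSpace ℝ (Fin I.n)) : Fin I.n → ℤ :=
  if h : I.IsNonsingular ∧ ∃ v ∈ dualLattice I.lattice, ‖t - v‖ < minNorm (dualLattice I.lattice) / 2 then
    haveI := I.isZLattice_of_isNonsingular h.1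
    fun j => (dualZBasis I).repr ⟨h.2.choose, h.2.choose_spec.1⟩ j
  else 0

/-- **The answer is the coordinate vector of any close dual lattice point.**
[cite: Regev2009, Lemma 3.4] -/
theorem coords_eq_repr (I : LatticeInstance) [IsZLattice ℝ I.lattice] {t : EuclideanSpace ℝ (Fin I.n)}
    (v : dualLattice I.lattice) (hvt : ‖t - v‖ < minNorm (dualLattice I.lattice) / 2) :
    coords I t = fun j => (dualZBasis I).repr v j := by
  have hI : I.IsNonsingular := isNonsingular_of_isZLattice I
  have hex : ∃ w ∈ dualLattice I.lattice, ‖t - w‖ < minNorm (dualLattice I.lattice) / 2 := ⟨v, v.2, hvt⟩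
  have h : I.IsNonsingular ∧ ∃ w ∈ dualLattice I.lattice, ‖t - w‖ < minNorm (dualLattice I.lattice) / 2 := ⟨hI, hex⟩
  classical
  rw [coords, dif_pos h]
  have hw : (⟨h.2.choose, h.2.choose_spec.1⟩ : dualLattice I.lattice) = v :=
    Subtype.ext (eq_of_norm_sub_lt I h.2.choose_spec.1 v.2 h.2.choose_spec.2 hvt)
  funext j
  rw [hw]

/-- The dual lattice point with coordinates `c`: `Σⱼ cⱼ b^∨ⱼ`. [folklore] -/
theorem coe_dualZBasis_repr_symm (I : LatticeInstance) [IsZLattice ℝ I.lattice] (v : dualLattice I.lattice) :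
    (v : EuclideanSpace ℝ (Fin I.n)) = ∑ j, ((dualZBasis I).repr v j : ℝ) • dualVec I j := by
  conv_lhs => rw [← (dualZBasis I).sum_repr v]
  simp only [Submodule.coe_sum, Submodule.coe_smul_of_tower, coe_dualZBasis]
  refine Finset.sum_congr rfl fun j _ => ?_
  rw [Int.cast_smul_eq_zsmul]

/-! ### The answer table, the query string and the ideal answer function -/

/-- **The answer**: the offset-binary table, entries of width `b_c`, of the dual coordinates of the
close point of `L(B)*` to the query point (`n · b_c` bits). [cite: Regev2009, Lemma 3.4 ("outputs L^{-1}κ_L(x)")] -/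
def answerTable (I : LatticeInstance) (c : QData I.n) : List Bool := tableZ c.2.2 (coords I (point I c))

/-- The answer table has `n · b_c` bits. [folklore] -/
theorem length_answerTable (I : LatticeInstance) (c : QData I.n) : (answerTable I c).length = I.n * c.2.2 := by
  unfold answerTable tableZ
  rw [List.length_flatten, List.map_ofFn, List.sum_ofFn]
  simp [Finset.sum_const, Finset.card_univ, Fintype.card_fin]

/-- **The query string**: the classical prefix — the sampler's stage input `⟨x, ⟨1^{k+1}, y⟩⟩` and the
numerals `⟨bin ℓ_R, bin b_c⟩` — paired with the residue table, which thus appears VERBATIM at the end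
(second field of `boolPair`). [cite: Regev2009, Lemma 3.3 (proof) and Lemma 3.14 (proof)] [cite: AroraBarak2009, §0.1] -/
def query (I : LatticeInstance) (r : ℚ) (k : ℕ) (y : List Bool) (c : QData I.n) : List Bool :=
  boolPair (boolPair (stageInput (GapSVPInstance.encode (I, r)) (k + 1) y)
      (boolPair (encodeNat c.2.1) (encodeNat c.2.2)))
    (table c.2.1 c.1)

/-- **In-range data are determined by their query strings.** [cite: AroraBarak2009, §0.1 (unique parsing of pairs)] -/
theorem query_injOn (I : LatticeInstance) (r : ℚ) (k : ℕ) (y : List Bool) {c c' : QData I.n}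
    (hc : InRange c) (hc' : InRange c') (heq : query I r k y c = query I r k y c') : c = c' := by
  have hpre := congrArg fstF heq
  simp only [query, fstF_boolPair] at hpre
  have hnums := congrArg sndF hpre
  simp only [sndF_boolPair] at hnums
  have hℓ : c.2.1 = c'.2.1 := QCircuit.encodeNat_injective (by
    have := congrArg fstF hnums
    simpa only [fstF_boolPair] using this)
  have hb : c.2.2 = c'.2.2 := QCircuit.encodeNat_injective (by
    have := congrArg sndF hnums
    simpa only [sndF_boolPair] using this)
  have htab := congrArg sndF heq
  simp only [query, sndF_boolPair] at htab
  rw [← hℓ] at htab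
  have hs : c.1 = c'.1 := table_injOn hc (fun j => hℓ ▸ hc' j) htab
  exact Prod.ext hs (Prod.ext hℓ hb)

/-- The classical prefix of the query string. [folklore] -/
@[simp] theorem fstF_query (I : LatticeInstance) (r : ℚ) (k : ℕ) (y : List Bool) (c : QData I.n) :
    fstF (query I r k y c) = boolPair (stageInput (GapSVPInstance.encode (I, r)) (k + 1) y)
      (boolPair (encodeNat c.2.1) (encodeNat c.2.2)) := fstF_boolPair _ _

/-- **The residue table is the second field of the query string, verbatim.** [folklore] -/
@[simp] theorem sndF_query (I : LatticeInstance) (r : ℚ) (k : ℕ) (y : List Bool) (c : QData I.n) :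
    sndF (query I r k y c) = table c.2.1 c.1 := sndF_boolPair _ _

/-- **The layout of the query string**: the doubled prefix, the separator `01`, then the table.
[cite: AroraBarak2009, §0.1] -/
theorem query_eq_append (I : LatticeInstance) (r : ℚ) (k : ℕ) (y : List Bool) (c : QData I.n) :
    query I r k y c = boolPair (fstF (query I r k y c)) [] ++ table c.2.1 c.1 := by
  rw [fstF_query, query, boolPair_append, List.nil_append]

open scoped Classical in
/-- **The ideal answer function** of a call of query width `kq` and answer width `ℓ` at `(I, r, k, y)`:
on the query string of in-range data `c`, the first `ℓ` bits of the answer table of `c` (`0` beyond the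
table); `0…0` on every other string. [cite: Regev2009, Lemma 3.3 (proof: "an oracle that solves CVP_{L*,αp/(√2 r)}")] -/
def answerFn (I : LatticeInstance) (r : ℚ) (k : ℕ) (y : List Bool) (kq ℓ : ℕ) (w : QReg kq) : QReg ℓ :=
  if h : ∃ c : QData I.n, InRange c ∧ List.ofFn w = query I r k y c then
    fun i : Fin ℓ => (answerTable I h.choose).getD (i : ℕ) false
  else fun _ => false

/-- **The ideal answer function on the query string of in-range data is its answer table.**
[cite: Regev2009, Lemma 3.3 (proof)] -/
theorem answerFn_query (I : LatticeInstance) (r : ℚ) (k : ℕ) (y : List Bool) (ℓ : ℕ) {c : QData I.n} (hc : InRange c) :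
    answerFn I r k y (query I r k y c).length ℓ (query I r k y c).get = fun i : Fin ℓ => (answerTable I c).getD (i : ℕ) false := by
  classical
  have hex : ∃ c' : QData I.n, InRange c' ∧ List.ofFn (query I r k y c).get = query I r k y c' :=
    ⟨c, hc, List.ofFn_get _⟩
  unfold answerFn
  rw [dif_pos hex]
  have hc' : hex.choose = c :=
    (query_injOn I r k y hc hex.choose_spec.1 ((List.ofFn_get _).symm.trans hex.choose_spec.2)).symm
  rw [hc']

/-- Off the query strings of in-range data the ideal answer function vanishes. [folklore] -/
theorem answerFn_of_not_exists (I : LatticeInstance) (r : ℚ) (k : ℕ) (y : List Bool) (kq ℓ : ℕ) {w : QReg kq}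
    (hw : ¬ ∃ c : QData I.n, InRange c ∧ List.ofFn w = query I r k y c) :
    answerFn I r k y kq ℓ w = fun _ => false := by
  classical
  unfold answerFn
  rw [dif_neg hw]

end CVPOracle

end Regev2009

end Literature.Computability.Cryptography

end
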